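import Summits.QuantumFields.YangMills.Theorems.BalabanUVNodesN15KingModelPotentialLogDet
import Summits.QuantumFields.YangMills.Theorems.BalabanUVNodesN15KingModelPotentialComplexLeaves
import Summits.QuantumFields.YangMills.Theorems.BalabanUVNodesN15KingModelPotentialComplexRowSum

/-!
# N15 (NE2) King-model rung, PART 42 — THE η-RATE OF AN INTENSIVE QUANTITY: the response of the log-determinant density converges GEOMETRICALLY in the
# cutoff, UNIFORMLY IN THE VOLUME, at every complex coupling of the disc; hence it has a `k → ∞` limit with a volume-uniform geometric tail

Eleventh generation (g11) of the seat `pub-ymgap-dag-n15-d`, part 42 (on 41 `…PotentialLogDet`, 39 `…PotentialComplexLeaves`, 40 `…PotentialComplexRowSum`).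
Part 41 defined the response `e_k(z) = |Λ|⁻¹·Σ_{x,y} C^{(k)}_z(x,y)·∂_zΔ^{(k)}_{z·v}(y,x)` of the Gaussian free energy per site and bounded it uniformly in `k` and in the
volume.  Its TWO-SPACING difference splits as
`e_{k+1} − e_k = |Λ|⁻¹·Σ_{x,y} (C^{(k+1)}_z − C^{(k)}_z)(x,y)·∂Δ^{(k+1)}(y,x) + |Λ|⁻¹·Σ_{x,y} C^{(k)}_z(x,y)·∂(Δ^{(k+1)} − Δ^{(k)})(y,x)`;
the first term is (ROW-SUM η-rate of the covariances, part 40 (iii)) × (sup of the level derivative, Cauchy on 32's decaying bound), the second is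
(row sum of `C^{(k)}_z`, part 40 (i)) × (sup of the derivative of the LEVEL DIFFERENCE, Cauchy on part 39's (H3) at complex coupling) — both volume-uniform:

* §1 `norm_doubleSum_mul_le` (generic: `|Λ|⁻¹·Σ_xΣ_y ‖A(x,y)‖·‖B(y,x)‖ ≤ (sup_x Σ_y‖A(x,y)‖)·(sup ‖B‖)`), `norm_deriv_kingLevelPotC_le` (Cauchy, order 1, on 32),
  `norm_deriv_kingLevel_sub_le` (Cauchy, order 1, on 39's (H3));
* §2 ★★★ `logDetResponseC_twoSpacing_rate` — for odd `L ≥ 3`, `a, m² > 0` there are `w₁, A > 0` and an exponent such that for every volume exponent `e`, every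
  tower of the window, every `0 < r < 1`, every circle `‖z‖ + ρ < (r∕(1+r))·min(r_K∕w₀, 1)` and every `k ≥ 1`:
  `‖e_{k+1}(z) − e_k(z)‖ ≤ (A∕ρ)·ϑ^k`, `ϑ = θ^{1−λ(r)} < 1` (`θ = L^{−1∕4}`; the level ratio `θ₂^{1−λ} = ϑ² ≤ ϑ`) — THE η-RATE OF THE FREE-ENERGY RESPONSE,
  UNIFORM IN THE VOLUME;
* §3 ★★ `logDetResponseC_limit` — hence `e_k(z)` converges as `k → ∞` (to `lim_k e_k(z)`) with the volume-uniform tail `‖e_{k+1}(z) − e_∞(z)‖ ≤ (A∕ρ)·ϑ^{k+1}∕(1−ϑ)`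
  (Mathlib `cauchySeq_of_le_geometric`, `dist_le_of_le_geometric_of_tendsto`).

References (method): Jacobi's formula (tree `LogDetDerivative`), Cauchy's estimate, geometric series [folklore]; two-constants via 32∕33∕39 (BY NAME);
template [B9] Thm 3.4 p.400; King Lemma 4.3 (4.18) p.672, (4.34), Lemma 4.5 (4.38) p.674, (4.41) p.675.

HONEST SCOPE.  King's A = 0 SCALAR model on the King-admissible tori (odd `L ≥ 3`, `a, m² > 0`), 10e's window intersected with `w₀ ≤ w̄`; the response of the
GAUSSIAN log-determinant per site (not the interacting vacuum energy, not Bałaban's `E`, not King's `Z_k`); the limit is identified only as the limit of the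
sequence (no closed form claimed); NOT a node discharge; count-neutral.  No `sorry`, standard axioms.
-/

noncomputable section

open scoped BigOperators Matrix
open Filter Topology Metric Finset Complex

namespace Summit.QuantumFields.YangMills.BalabanUVNodes.N15.KingModel

open Literature.MathematicalPhysics.QuantumFieldTheory.Balaban1983to89 hiding blockOf
open Literature.MathematicalPhysics.QuantumFieldTheory.Balaban1983to89.B4Sect5Proof (latticeConst latticeConst_nonneg)
open Literature.MathematicalPhysics.QuantumFieldTheory.Balaban1983to89.B5Prop11Plancherel (Tor fine)
open Literature.MathematicalPhysics.QuantumFieldTheory.Balaban1983to89.B13RealSliceEntryLetters (lam lam_nonneg lam_lt_one)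
open Literature.MathematicalPhysics.QuantumFieldTheory.King1986 (aK aK_pos aK_le)
open Literature.MathematicalPhysics.QuantumFieldTheory.King1986.Torus (gam0L gam0L_pos tdistT tdistT_isPseudoDist tdistT_sumBound kapCT kapCT_pos_le)
open Summit.QuantumFields.YangMills.BalabanUVNodes.N15KingModelRung.Curved (underPtN)

variable {d : ℕ}

/-! ## §1 Generic double-sum bound and the two Cauchy estimates -/

/-- **Row sum × sup**: `‖Σ_x Σ_y A(x,y)·B(y,x)‖ ≤ |Λ|·R·S` when every row sum of `‖A‖` is `≤ R` and `‖B‖ ≤ S` entrywise. [folklore] -/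
theorem norm_doubleSum_mul_le {ι : Type*} [Fintype ι] {A B : ι → ι → ℂ} {R S : ℝ} (hS : 0 ≤ S)
    (hA : ∀ x, ∑ y, ‖A x y‖ ≤ R) (hB : ∀ x y, ‖B x y‖ ≤ S) :
    ‖∑ x, ∑ y, A x y * B y x‖ ≤ Fintype.card ι * (R * S) := by
  calc ‖∑ x, ∑ y, A x y * B y x‖ ≤ ∑ x, ‖∑ y, A x y * B y x‖ := norm_sum_le _ _
    _ ≤ ∑ x, ∑ y, ‖A x y‖ * S := by
        refine sum_le_sum fun x _ => (norm_sum_le _ _).trans (sum_le_sum fun y _ => ?_)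
        rw [norm_mul]
        exact mul_le_mul_of_nonneg_left (hB y x) (norm_nonneg _)
    _ = ∑ x, (∑ y, ‖A x y‖) * S := by refine sum_congr rfl fun x _ => ?_; rw [sum_mul]
    _ ≤ ∑ _x : ι, R * S := sum_le_sum fun x _ => mul_le_mul_of_nonneg_right (hA x) hS
    _ = Fintype.card ι * (R * S) := by rw [sum_const, card_univ, nsmul_eq_mul]

section KingU

variable (L : ℕ) [NeZero L]

/-- **Cauchy, order 1, on 32's decaying level bound**: on a circle `‖z‖ + ρ < (r∕(1+r))·min(r_K∕w₀,1)` (window `w₀ ≤ w̄`), `k ≥ 1`: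
`‖∂_z Δ^{(k)}_{z·v}(b,b′)‖ ≤ M_Δ∕ρ`, `M_Δ = max(a + a²ctCK, a + 2a²∕m²)`. [folklore] -/
theorem norm_deriv_kingLevelPotC_le {a m2 : ℝ} (ha : 0 < a) (hm : 0 < m2) (hL : 2 ≤ L) {e : ℕ} {k : ℕ} (hk : 1 ≤ k)
    {v : ∀ N : ℕ, Tor (fine N (kingU d L e)) → ℝ} {w₀ : ℝ} (hw₀ : 0 < w₀) (hwb : w₀ ≤ wbarK (d + 1) a L) (hv : ∀ N x, |v N x| ≤ w₀)
    {r : ℝ} (hr0 : 0 < r) (hr1 : r < 1) {z : ℂ} {ρ : ℝ} (hρ : 0 < ρ) (hzρ : ‖z‖ + ρ < r / (1 + r) * min (cplxWindow d a m2 L / w₀) 1)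
    (b b' : Tor (kingU d L e)) :
    ‖deriv (fun ζ : ℂ => kingLevelPotC d a m2 L (kingM d L e) k ζ (v (L ^ k)) b b') z‖ ≤ max (a + a ^ 2 * ctCK (d + 1) a L) (a + 2 * a ^ 2 / m2) / ρ := by
  have hwin := cplxWindow_pos (d := d) (a := a) (m2 := m2) (L := L) ha hm hL
  obtain ⟨hrad, -⟩ := disc_radius_le (d := d) (a := a) (m2 := m2) L hr0 hw₀ hwin
  have hd0 : ∀ b b' : Tor (kingU d L e), 0 ≤ tdistT (kingU d L e) b b' := (tdistT_isPseudoDist (kingU d L e)).nonneg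
  set MΔ : ℝ := max (a + a ^ 2 * ctCK (d + 1) a L) (a + 2 * a ^ 2 / m2) with hMΔ
  have hMΔ0 : 0 ≤ MΔ := le_trans (by have := (dressedConsts_nonneg (d := d) (a := a) (L := L) ha hL).1; positivity) (le_max_left _ _)
  have hlam1 := lam_lt_one r
  have hκ := (kapCT_pos_le (d := d + 1) ha hL).1
  have h := norm_iteratedDeriv_le_of_sphere (f := fun ζ : ℂ => kingLevelPotC d a m2 L (kingM d L e) k ζ (v (L ^ k)) b b') hρ hzρ
    ((differentiableOn_kingLevelPotC_ball (d := d) ha hm hL hk hw₀ (hv _) b b').mono (ball_subset_ball hrad))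
    (fun ζ hζ => (kingLevelPotC_apply_decay (M := kingM d L e) (m2 := m2) ha hm hL hk hw₀ hwb hv hr0 hr1
        (mem_ball_zero_iff.1 (closedBall_subset_ball_of_norm_add_lt hzρ (sphere_subset_closedBall hζ))) b b').trans
        (mul_le_of_le_one_right hMΔ0 (Real.exp_le_one_iff.mpr (by
          have : 0 ≤ (1 - lam r) * (2 * kapCT (d + 1) a L) * tdistT (kingU d L e) b b' := by
            have := hd0 b b'; positivity
          linarith)))) 1
  rw [iteratedDeriv_one, Nat.factorial_one, Nat.cast_one, one_mul, pow_one] at h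
  exact h

/-- **Cauchy, order 1, on 39's (H3) at complex coupling**: there are `w₁, E > 0` (39's) such that in the window, for every circle
`‖z‖ + ρ < (r∕(1+r))·min(r_K∕w₀,1)` and every `k`:
`‖∂_z(Δ^{(k+2)}_{z·v} − Δ^{(k+1)}_{z·v})(b,b′)‖ ≤ E^{1−λ}·M_E^{λ}·(θ₂^{1−λ})^{k+1}∕ρ` (the derivative of the difference = the difference of the derivatives).
[cite: King1986, Lemma 4.3 (4.18) p.672 (A = 0 template); Ransford1995, Thm. 4.3.7] -/
theorem norm_deriv_kingLevel_sub_le (hLodd : Odd L) (hL : 2 ≤ L) {a m2 : ℝ} (ha : 0 < a) (hm : 0 < m2) :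
    ∃ w₁ E : ℝ, 0 < w₁ ∧ 0 < E ∧
      ∀ (e : ℕ) (v : ∀ N : ℕ, Tor (fine N (kingU d L e)) → ℝ) (w₀ ν₀ s : ℝ),
      0 ≤ ν₀ → ν₀ ≤ w₁ → 0 ≤ s → s ≤ (L : ℝ) ^ (-(1 / 2 : ℝ)) →
      0 < w₀ → (∀ (N : ℕ) (x : Tor (fine N (kingU d L e))), |v N x| ≤ w₀) → w₀ ≤ w₁ →
      (∀ (k : ℕ), 1 ≤ k → ∀ x' : Tor (fine (L ^ 1 * L ^ k) (kingU d L e)),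
          |v (L ^ 1 * L ^ k) x' - v (L ^ k) (underPtN L k 1 (kingU d L e) x')| ≤ ν₀ * s ^ k) →
      ∀ (b b' : Tor (kingU d L e)) (k : ℕ) (r : ℝ), 0 < r → r < 1 → ∀ (z : ℂ) (ρ : ℝ), 0 < ρ →
        ‖z‖ + ρ < r / (1 + r) * min (cplxWindow d a m2 L / w₀) 1 →
        ‖deriv (fun ζ : ℂ => kingLevelPotC d a m2 L (kingM d L e) (k + 2) ζ (v (L ^ (k + 2))) b b') z
            - deriv (fun ζ : ℂ => kingLevelPotC d a m2 L (kingM d L e) (k + 1) ζ (v (L ^ (k + 1))) b b') z‖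
          ≤ E ^ (1 - lam r) * (max E (2 * (a + 2 * a ^ 2 / m2))) ^ lam r * ((((L : ℝ) ^ (-(1 / 2 : ℝ))) ^ (1 - lam r)) ^ (k + 1)) / ρ := by
  obtain ⟨w₁, E, hw₁, hE, H⟩ := kingLevel_twoSpacing_complexRate (d := d) L hLodd hL ha hm
  refine ⟨w₁, E, hw₁, hE, ?_⟩
  intro e v w₀ ν₀ s hν₀ hν₁ hs0 hs1 hw₀ hv hw₁' hcoh b b' k r hr0 hr1 z ρ hρ hzρ
  have hwin := cplxWindow_pos (d := d) (a := a) (m2 := m2) (L := L) ha hm hL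
  obtain ⟨hrad, -⟩ := disc_radius_le (d := d) (a := a) (m2 := m2) L hr0 hw₀ hwin
  have hk1 : 1 ≤ k + 1 := Nat.succ_le_succ (Nat.zero_le k)
  have hk2 : 1 ≤ k + 2 := Nat.succ_le_succ (Nat.zero_le _)
  have hd2 := (differentiableOn_kingLevelPotC_ball (d := d) ha hm hL hk2 hw₀ (hv (L ^ (k + 2))) b b').mono (ball_subset_ball hrad)
  have hd1 := (differentiableOn_kingLevelPotC_ball (d := d) ha hm hL hk1 hw₀ (hv (L ^ (k + 1))) b b').mono (ball_subset_ball hrad)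
  have hz0 : z ∈ ball (0 : ℂ) (r / (1 + r) * min (cplxWindow d a m2 L / w₀) 1) := by
    rw [mem_ball_zero_iff]; linarith [norm_nonneg z]
  have hopen : IsOpen (ball (0 : ℂ) (r / (1 + r) * min (cplxWindow d a m2 L / w₀) 1)) := isOpen_ball
  -- the derivative of the difference is the difference of the derivatives
  have hsub : deriv (fun ζ : ℂ => kingLevelPotC d a m2 L (kingM d L e) (k + 2) ζ (v (L ^ (k + 2))) b b'
        - kingLevelPotC d a m2 L (kingM d L e) (k + 1) ζ (v (L ^ (k + 1))) b b') z
      = deriv (fun ζ : ℂ => kingLevelPotC d a m2 L (kingM d L e) (k + 2) ζ (v (L ^ (k + 2))) b b') z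
        - deriv (fun ζ : ℂ => kingLevelPotC d a m2 L (kingM d L e) (k + 1) ζ (v (L ^ (k + 1))) b b') z :=
    deriv_sub (hd2.differentiableAt (hopen.mem_nhds hz0)) (hd1.differentiableAt (hopen.mem_nhds hz0))
  rw [← hsub]
  have h := norm_iteratedDeriv_le_of_sphere
    (f := fun ζ : ℂ => kingLevelPotC d a m2 L (kingM d L e) (k + 2) ζ (v (L ^ (k + 2))) b b' - kingLevelPotC d a m2 L (kingM d L e) (k + 1) ζ (v (L ^ (k + 1))) b b')
    hρ hzρ (hd2.sub hd1)
    (fun ζ hζ => H e v w₀ ν₀ s hν₀ hν₁ hs0 hs1 hw₀ hv hw₁' hcoh b b' k r hr0 hr1 ζ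
      (mem_ball_zero_iff.1 (closedBall_subset_ball_of_norm_add_lt hzρ (sphere_subset_closedBall hζ)))) 1
  rw [iteratedDeriv_one, Nat.factorial_one, Nat.cast_one, one_mul, pow_one] at h
  exact h

/-! ## §2 The η-rate of the response, uniformly in the volume -/

/-- ★★★ **THE η-RATE OF THE FREE-ENERGY RESPONSE, UNIFORMLY IN THE VOLUME.**  For odd `L ≥ 3`, `a, m² > 0` there are `w₁, A > 0` such that for every volume
exponent `e`, every potential tower with `sup|v_N| ≤ w₀ ≤ w₁`, `w₀ > 0`, coherence defect `≤ ν₀s^k` (`0 ≤ ν₀ ≤ w₁`, `0 ≤ s ≤ L^{−1∕2}`), every `0 < r < 1`,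
every coupling `z` and radius `ρ > 0` with `‖z‖ + ρ < (r∕(1+r))·min(r_K∕w₀, 1)`, and every `k ≥ 1`:
`‖e_{k+1}(z) − e_k(z)‖ ≤ A·K_r∕ρ·ϑ^k` with `ϑ = (L^{−1∕4})^{1−λ(r)}` and an explicit `r`-dependent factor
`K_r = (1 + max(C,4∕γ₀))·(K((1−λ)κ₂∕2) + K((1−λ)κ₁))·(1 + max(E, 2(a+2a²∕m²)))` — every constant independent of `k`, of the volume and of `v`.
(Splitting `e_{k+1} − e_k = |Λ|⁻¹ΣΣ (C^{(k+1)}−C^{(k)})·∂Δ^{(k+1)} + |Λ|⁻¹ΣΣ C^{(k)}·∂(Δ^{(k+1)}−Δ^{(k)})`: part 40's row-sum letters × §1's Cauchy estimates;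
the level ratio `θ₂^{1−λ} = ϑ²` is dominated by `ϑ`.)
[cite: King1986, Lemma 4.3 (4.18) p.672, Lemma 4.5 (4.38) p.674, (4.41) p.675 (A = 0 template); Balaban1985BackgroundPropagators, Thm 3.4 p.400; Ransford1995, Thm. 4.3.7] -/
theorem logDetResponseC_twoSpacing_rate (hLodd : Odd L) (hL : 2 ≤ L) {a m2 : ℝ} (ha : 0 < a) (hm : 0 < m2) :
    ∃ κ₁ κ₂ w₁ C E : ℝ, 0 < κ₁ ∧ 0 < κ₂ ∧ 0 < w₁ ∧ 0 < C ∧ 0 < E ∧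
      ∀ (e : ℕ) (v : ∀ N : ℕ, Tor (fine N (kingU d L e)) → ℝ) (w₀ ν₀ s : ℝ),
      0 ≤ ν₀ → ν₀ ≤ w₁ → 0 ≤ s → s ≤ (L : ℝ) ^ (-(1 / 2 : ℝ)) →
      0 < w₀ → (∀ (N : ℕ) (x : Tor (fine N (kingU d L e))), |v N x| ≤ w₀) → w₀ ≤ w₁ →
      (∀ (k : ℕ), 1 ≤ k → ∀ x' : Tor (fine (L ^ 1 * L ^ k) (kingU d L e)),
          |v (L ^ 1 * L ^ k) x' - v (L ^ k) (underPtN L k 1 (kingU d L e) x')| ≤ ν₀ * s ^ k) →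
      ∀ (r : ℝ), 0 < r → r < 1 → ∀ (z : ℂ) (ρ : ℝ), 0 < ρ → ‖z‖ + ρ < r / (1 + r) * min (cplxWindow d a m2 L / w₀) 1 →
      ∀ k : ℕ, 1 ≤ k →
        ‖logDetResponseC d a m2 L (kingM d L e) (k + 1) (v (L ^ (k + 1))) z - logDetResponseC d a m2 L (kingM d L e) k (v (L ^ k)) z‖
          ≤ (C ^ (1 - lam r) * (max C (4 / gam0L (d + 1) a L)) ^ lam r * latticeConst (d + 1) ((1 - lam r) * (κ₂ / 2))
                * (max (a + a ^ 2 * ctCK (d + 1) a L) (a + 2 * a ^ 2 / m2) / ρ)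
              + 4 / gam0L (d + 1) a L * latticeConst (d + 1) ((1 - lam r) * κ₁)
                * (E ^ (1 - lam r) * (max E (2 * (a + 2 * a ^ 2 / m2))) ^ lam r / ρ))
            * ((((L : ℝ) ^ (-(1 / 4 : ℝ))) ^ (1 - lam r)) ^ k) := by
  obtain ⟨κ₁, κ₂, w₁, C, hκ₁, hκ₂, hw₁, hC, HR⟩ := kingCov_complexCoupling_rowSums (d := d) L hLodd hL ha hm
  obtain ⟨w₂, E, hw₂, hE, HD⟩ := norm_deriv_kingLevel_sub_le (d := d) L hLodd hL ha hm
  have hwb := (dressedConsts_nonneg (d := d) (a := a) (L := L) ha hL).2.2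
  refine ⟨κ₁, κ₂, min (min w₁ w₂) (wbarK (d + 1) a L), C, E, hκ₁, hκ₂, lt_min (lt_min hw₁ hw₂) hwb, hC, hE, ?_⟩
  intro e v w₀ ν₀ s hν₀ hν₁ hs0 hs1 hw₀ hv hw₁' hcoh r hr0 hr1 z ρ hρ hzρ k hk
  have hν1 : ν₀ ≤ w₁ := hν₁.trans ((min_le_left _ _).trans (min_le_left _ _))
  have hν2 : ν₀ ≤ w₂ := hν₁.trans ((min_le_left _ _).trans (min_le_right _ _))
  have hwa : w₀ ≤ w₁ := hw₁'.trans ((min_le_left _ _).trans (min_le_left _ _))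
  have hwc : w₀ ≤ w₂ := hw₁'.trans ((min_le_left _ _).trans (min_le_right _ _))
  have hwbar : w₀ ≤ wbarK (d + 1) a L := hw₁'.trans (min_le_right _ _)
  have hγ := gam0L_pos (d := d + 1) ha hL
  have hlam0 := lam_nonneg hr0.le hr1
  have hlam1 := lam_lt_one r
  have hz : ‖z‖ < r / (1 + r) * min (cplxWindow d a m2 L / w₀) 1 := by linarith [norm_nonneg z]
  have hk1 : 1 ≤ k + 1 := Nat.succ_le_succ (Nat.zero_le k)
  set θ : ℝ := (L : ℝ) ^ (-(1 / 4 : ℝ)) with hθ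
  set θ₂ : ℝ := (L : ℝ) ^ (-(1 / 2 : ℝ)) with hθ₂
  set ϑ : ℝ := θ ^ (1 - lam r) with hϑ
  have hθ0 : 0 ≤ θ := Real.rpow_nonneg (Nat.cast_nonneg _) _
  have hθ20 : 0 ≤ θ₂ := Real.rpow_nonneg (Nat.cast_nonneg _) _
  have hθ1 : θ ≤ 1 := by
    have hL1 : (1 : ℝ) ≤ L := by exact_mod_cast (by omega : 1 ≤ L)
    exact Real.rpow_le_one_of_one_le_of_nonpos hL1 (by norm_num)
  have hϑ0 : 0 ≤ ϑ := Real.rpow_nonneg hθ0 _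
  have hϑ1 : ϑ ≤ 1 := Real.rpow_le_one hθ0 hθ1 (by linarith)
  -- θ₂ = θ², so θ₂^{1−λ} = ϑ² ≤ ϑ
  have hθ₂eq : θ₂ = θ ^ 2 := by
    rw [hθ₂, hθ, ← Real.rpow_natCast, ← Real.rpow_mul (Nat.cast_nonneg _)]
    norm_num
  have hϑ₂le : ∀ n : ℕ, (θ₂ ^ (1 - lam r)) ^ n ≤ ϑ ^ n := by
    intro n
    apply pow_le_pow_left₀ (Real.rpow_nonneg hθ20 _)
    rw [hθ₂eq, ← Real.rpow_natCast θ 2, ← Real.rpow_mul hθ0, mul_comm, Real.rpow_mul hθ0, Real.rpow_natCast]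
    calc ϑ ^ 2 = ϑ * ϑ := sq ϑ
      _ ≤ ϑ * 1 := mul_le_mul_of_nonneg_left hϑ1 hϑ0
      _ = ϑ := mul_one ϑ
  -- the letters
  have HRx := HR e v w₀ ν₀ s hν₀ hν1 hs0 hs1 hw₀ hv hwa hcoh r hr0 hr1 z hz
  set MΔ : ℝ := max (a + a ^ 2 * ctCK (d + 1) a L) (a + 2 * a ^ 2 / m2) with hMΔ
  have hMΔ0 : 0 ≤ MΔ := le_trans (by have := (dressedConsts_nonneg (d := d) (a := a) (L := L) ha hL).1; positivity) (le_max_left _ _)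
  set ME : ℝ := E ^ (1 - lam r) * (max E (2 * (a + 2 * a ^ 2 / m2))) ^ lam r with hME
  have hME0 : 0 ≤ ME := by have : 0 ≤ max E (2 * (a + 2 * a ^ 2 / m2)) := hE.le.trans (le_max_left _ _); positivity
  have hMC0 : 0 ≤ C ^ (1 - lam r) * (max C (4 / gam0L (d + 1) a L)) ^ lam r := by
    have : 0 ≤ max C (4 / gam0L (d + 1) a L) := hC.le.trans (le_max_left _ _); positivity
  have hK1 : 0 ≤ latticeConst (d + 1) ((1 - lam r) * κ₁) := latticeConst_nonneg _ (by nlinarith)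
  have hK2 : 0 ≤ latticeConst (d + 1) ((1 - lam r) * (κ₂ / 2)) := latticeConst_nonneg _ (by nlinarith)
  -- sup bounds on the derivatives
  have hsupD : ∀ y x, ‖deriv (fun ζ : ℂ => kingLevelPotC d a m2 L (kingM d L e) (k + 1) ζ (v (L ^ (k + 1))) y x) z‖ ≤ MΔ / ρ := fun y x =>
    norm_deriv_kingLevelPotC_le (d := d) L ha hm hL hk1 hw₀ hwbar hv hr0 hr1 hρ hzρ y x
  have hsupDD : ∀ y x, ‖deriv (fun ζ : ℂ => kingLevelPotC d a m2 L (kingM d L e) (k + 1) ζ (v (L ^ (k + 1))) y x) z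
        - deriv (fun ζ : ℂ => kingLevelPotC d a m2 L (kingM d L e) k ζ (v (L ^ k)) y x) z‖ ≤ ME * ϑ ^ k / ρ := by
    intro y x
    obtain ⟨k', rfl⟩ : ∃ k', k = k' + 1 := ⟨k - 1, by omega⟩
    have h := HD e v w₀ ν₀ s hν₀ hν2 hs0 hs1 hw₀ hv hwc hcoh y x k' r hr0 hr1 z ρ hρ hzρ
    refine h.trans ?_
    rw [hME]
    exact div_le_div_of_nonneg_right (mul_le_mul_of_nonneg_left (hϑ₂le (k' + 1)) hME0) hρ.le
  -- the split
  set n : ℕ := Fintype.card (Tor (kingU d L e)) with hn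
  have hn0 : (0 : ℝ) < n := by exact_mod_cast (Fintype.card_pos : 0 < n)
  set C1 := fun x y => kingCovPotC d a m2 L (kingM d L e) (k + 1) z (v (L ^ (k + 1))) x y with hC1
  set C0 := fun x y => kingCovPotC d a m2 L (kingM d L e) k z (v (L ^ k)) x y with hC0
  set D1 := fun y x => deriv (fun ζ : ℂ => kingLevelPotC d a m2 L (kingM d L e) (k + 1) ζ (v (L ^ (k + 1))) y x) z with hD1
  set D0 := fun y x => deriv (fun ζ : ℂ => kingLevelPotC d a m2 L (kingM d L e) k ζ (v (L ^ k)) y x) z with hD0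
  have hsplit : logDetResponseC d a m2 L (kingM d L e) (k + 1) (v (L ^ (k + 1))) z - logDetResponseC d a m2 L (kingM d L e) k (v (L ^ k)) z
      = ((n : ℂ))⁻¹ * (∑ x, ∑ y, (C1 x y - C0 x y) * D1 y x + ∑ x, ∑ y, C0 x y * (D1 y x - D0 y x)) := by
    simp only [logDetResponseC, hC1, hC0, hD1, hD0, hn]
    rw [← mul_sub, ← sum_add_distrib]
    congr 1
    rw [← sum_sub_distrib]
    refine sum_congr rfl fun x _ => ?_
    rw [← sum_add_distrib, ← sum_sub_distrib]
    refine sum_congr rfl fun y _ => ?_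
    ring
  have h1 : ‖∑ x, ∑ y, (C1 x y - C0 x y) * D1 y x‖
      ≤ n * ((C ^ (1 - lam r) * (max C (4 / gam0L (d + 1) a L)) ^ lam r * latticeConst (d + 1) ((1 - lam r) * (κ₂ / 2)) * ϑ ^ k) * (MΔ / ρ)) :=
    norm_doubleSum_mul_le (by positivity) (fun x => by simpa only [hC1, hC0] using (HRx x).2.2.1 k hk) (fun y x => hsupD y x)
  have h2 : ‖∑ x, ∑ y, C0 x y * (D1 y x - D0 y x)‖
      ≤ n * ((4 / gam0L (d + 1) a L * latticeConst (d + 1) ((1 - lam r) * κ₁)) * (ME * ϑ ^ k / ρ)) :=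
    norm_doubleSum_mul_le (by positivity) (fun x => by simpa only [hC0] using (HRx x).1 k hk) (fun y x => hsupDD y x)
  rw [hsplit, norm_mul, norm_inv, Complex.norm_natCast]
  calc (n : ℝ)⁻¹ * ‖∑ x, ∑ y, (C1 x y - C0 x y) * D1 y x + ∑ x, ∑ y, C0 x y * (D1 y x - D0 y x)‖
      ≤ (n : ℝ)⁻¹ * (n * ((C ^ (1 - lam r) * (max C (4 / gam0L (d + 1) a L)) ^ lam r * latticeConst (d + 1) ((1 - lam r) * (κ₂ / 2)) * ϑ ^ k) * (MΔ / ρ))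
          + n * ((4 / gam0L (d + 1) a L * latticeConst (d + 1) ((1 - lam r) * κ₁)) * (ME * ϑ ^ k / ρ))) :=
        mul_le_mul_of_nonneg_left ((norm_add_le _ _).trans (add_le_add h1 h2)) (inv_nonneg.mpr hn0.le)
    _ = (C ^ (1 - lam r) * (max C (4 / gam0L (d + 1) a L)) ^ lam r * latticeConst (d + 1) ((1 - lam r) * (κ₂ / 2)) * (MΔ / ρ)
          + 4 / gam0L (d + 1) a L * latticeConst (d + 1) ((1 - lam r) * κ₁) * (ME / ρ)) * ϑ ^ k := by
        field_simp

/-! ## §3 The limit of the response -/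

/-- ★★ **THE RESPONSE CONVERGES AS `k → ∞`, WITH A GEOMETRIC TAIL UNIFORM IN THE VOLUME.**  With the data of `logDetResponseC_twoSpacing_rate` (towers of the
window, the circle `‖z‖ + ρ < (r∕(1+r))·min(r_K∕w₀, 1)`), writing `A_r(ρ)` for its constant and `ϑ = (L^{−1∕4})^{1−λ(r)}`: the sequence `k ↦ e_{k+1}(z)`
converges to `e_∞(z) := lim_k e_{k+1}(z)` and `‖e_{k+1}(z) − e_∞(z)‖ ≤ A_r(ρ)·ϑ^{k+1}∕(1−ϑ)` for every `k` — the continuum limit of the free-energy response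
exists at every complex coupling of the disc with a volume-uniform geometric rate (Mathlib `cauchySeq_of_le_geometric`, `dist_le_of_le_geometric_of_tendsto`).
[cite: King1986, §4 pp.675–676, Lemma 4.5 (4.38) p.674 (A = 0 template); Balaban1985BackgroundPropagators, Thm 3.4 p.400] -/
theorem logDetResponseC_limit (hLodd : Odd L) (hL : 2 ≤ L) {a m2 : ℝ} (ha : 0 < a) (hm : 0 < m2) :
    ∃ κ₁ κ₂ w₁ C E : ℝ, 0 < κ₁ ∧ 0 < κ₂ ∧ 0 < w₁ ∧ 0 < C ∧ 0 < E ∧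
      ∀ (e : ℕ) (v : ∀ N : ℕ, Tor (fine N (kingU d L e)) → ℝ) (w₀ ν₀ s : ℝ),
      0 ≤ ν₀ → ν₀ ≤ w₁ → 0 ≤ s → s ≤ (L : ℝ) ^ (-(1 / 2 : ℝ)) →
      0 < w₀ → (∀ (N : ℕ) (x : Tor (fine N (kingU d L e))), |v N x| ≤ w₀) → w₀ ≤ w₁ →
      (∀ (k : ℕ), 1 ≤ k → ∀ x' : Tor (fine (L ^ 1 * L ^ k) (kingU d L e)),
          |v (L ^ 1 * L ^ k) x' - v (L ^ k) (underPtN L k 1 (kingU d L e) x')| ≤ ν₀ * s ^ k) →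
      ∀ (r : ℝ), 0 < r → r < 1 → ∀ (z : ℂ) (ρ : ℝ), 0 < ρ → ‖z‖ + ρ < r / (1 + r) * min (cplxWindow d a m2 L / w₀) 1 →
        let eS : ℕ → ℂ := fun k => logDetResponseC d a m2 L (kingM d L e) (k + 1) (v (L ^ (k + 1))) z
        let A : ℝ := (C ^ (1 - lam r) * (max C (4 / gam0L (d + 1) a L)) ^ lam r * latticeConst (d + 1) ((1 - lam r) * (κ₂ / 2))
                * (max (a + a ^ 2 * ctCK (d + 1) a L) (a + 2 * a ^ 2 / m2) / ρ)
              + 4 / gam0L (d + 1) a L * latticeConst (d + 1) ((1 - lam r) * κ₁)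
                * (E ^ (1 - lam r) * (max E (2 * (a + 2 * a ^ 2 / m2))) ^ lam r / ρ))
        let ϑ : ℝ := (((L : ℝ) ^ (-(1 / 4 : ℝ))) ^ (1 - lam r))
        Tendsto eS atTop (𝓝 (limUnder atTop eS)) ∧
          ∀ k : ℕ, ‖eS k - limUnder atTop eS‖ ≤ (A * ϑ) * ϑ ^ k / (1 - ϑ) := by
  obtain ⟨κ₁, κ₂, w₁, C, E, hκ₁, hκ₂, hw₁, hC, hE, H⟩ := logDetResponseC_twoSpacing_rate (d := d) L hLodd hL ha hm
  refine ⟨κ₁, κ₂, w₁, C, E, hκ₁, hκ₂, hw₁, hC, hE, ?_⟩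
  intro e v w₀ ν₀ s hν₀ hν₁ hs0 hs1 hw₀ hv hw₁' hcoh r hr0 hr1 z ρ hρ hzρ eS A ϑ
  have hlam1 := lam_lt_one r
  have hθ0 : 0 ≤ (L : ℝ) ^ (-(1 / 4 : ℝ)) := Real.rpow_nonneg (Nat.cast_nonneg _) _
  have hθ1 : (L : ℝ) ^ (-(1 / 4 : ℝ)) < 1 := by
    have hL1 : (1 : ℝ) < L := by exact_mod_cast (by omega : 1 < L)
    exact Real.rpow_lt_one_of_one_lt_of_neg hL1 (by norm_num)
  have hϑ1 : ϑ < 1 := Real.rpow_lt_one hθ0 hθ1 (by linarith)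
  have hstep : ∀ k, dist (eS k) (eS (k + 1)) ≤ (A * ϑ) * ϑ ^ k := by
    intro k
    rw [dist_eq_norm, ← norm_neg, neg_sub]
    have h := H e v w₀ ν₀ s hν₀ hν₁ hs0 hs1 hw₀ hv hw₁' hcoh r hr0 hr1 z ρ hρ hzρ (k + 1) (Nat.succ_le_succ (Nat.zero_le k))
    calc ‖eS (k + 1) - eS k‖ = ‖logDetResponseC d a m2 L (kingM d L e) (k + 1 + 1) (v (L ^ (k + 1 + 1))) z
          - logDetResponseC d a m2 L (kingM d L e) (k + 1) (v (L ^ (k + 1))) z‖ := rfl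
      _ ≤ A * ϑ ^ (k + 1) := h
      _ = (A * ϑ) * ϑ ^ k := by rw [pow_succ]; ring
  have hcauchy : CauchySeq eS := cauchySeq_of_le_geometric ϑ (A * ϑ) hϑ1 hstep
  have hlim : Tendsto eS atTop (𝓝 (limUnder atTop eS)) := hcauchy.tendsto_limUnder
  refine ⟨hlim, fun k => ?_⟩
  have key := dist_le_of_le_geometric_of_tendsto ϑ (A * ϑ) hϑ1 hstep hlim k
  rwa [dist_eq_norm] at key

end KingU

end Summit.QuantumFields.YangMills.BalabanUVNodes.N15.KingModel

end
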